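import Literature.Analysis.FluidPDE.CompressibleEulerImplosionRates
import Summits.AtomisticToContinuum.HydrodynamicLimit.Theorems.ImplosionDichotomyTypeOneExterior
import Summits.AtomisticToContinuum.HydrodynamicLimit.Theorems.ImplosionDichotomyTypeOneReversal
import Summits.AtomisticToContinuum.HydrodynamicLimit.Theorems.ImplosionDichotomyTypeOneComparison
import Summits.AtomisticToContinuum.HydrodynamicLimit.Theorems.ImplosionDichotomyTypeOneGlueSolution
import Summits.AtomisticToContinuum.HydrodynamicLimit.Theorems.ImplosionDichotomyTypeOneRates

/-!
# The periodic Type-I implosion of the monatomic gas: assembly of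
# `CaolaboraEtAl2025_thm12_rates` from the BCG profile and local well-posedness

Helper file for the support item `TypeOneIdealImplosion` (stmt-AtomisticToContinuum-15146) of the
route `ImplosionDichotomy` (`AtomisticToContinuum/HydrodynamicLimit`). It assembles the transplant
of the exact self-similar implosion of the monatomic ideal gas (`γ = 5/3`) to the unit torus
(Cao-Labora–Gómez-Serrano–Shi–Staffilani, arXiv:2310.05325, Rem. 1.5 p. 7: the periodic Euler
result "can be easily deduced from the non-periodic one via finite speed of propagation") from
the landed pieces:

1. the Buckmaster–Cao-Labora–Gómez-Serrano profile (named fact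
   `BuckmasterCaolaboraGomezserrano2025_thm11_monatomic`, hypothesis) and its far field
   `U = ζ^{1−r}A(ζ^{−r})`, `S = ζ^{1−r}B(ζ^{−r})` (`CaolaboraEtAl2025.farField_of_profile`);
2. the exact solution `E` with blow-up time `T` (`CaolaboraEtAl2025.exactSolution_of_profile`);
3. the EXTERIOR solution, built BACKWARDS from the blow-up time: smooth torus data equal to the
   terminal far-field state on an annulus (`exists_torus_datum`), the classical isentropic
   solution they launch (`exists_isentropic_solution_of_lwp`, from the named fact
   `CompressibleEulerLocalWellPosedness`, hypothesis) on `[0, T_b)`, its agreement with the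
   reversed far field on `1/16 ≤ |y| ≤ 1/8` for reversed times `s < T'` once `T'` is small
   (`backward_agreement`, domain of dependence), and its time reversal
   (`isIsentropicEulerSolution_reverse`) — NO lower bound on the life span is needed, only
   `T < T' < T_b`;
4. the glue (`isIsentropicEulerSolution_glue`) and the four rate clauses (`glue_typeI`,
   `glue_iteratedFDeriv_le`, `glue_floor`, `glue_core_law`), fed with the compactness bounds of
   the exterior solution on `[0, T] × 𝕋³` (`exists_bound_partialDeriv_slice`,
   `exists_bound_iteratedFDeriv_lift_slice`, `exists_pos_le_slice`).

Main result: `thm12_rates_of_thm11_of_lwp :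
  BuckmasterCaolaboraGomezserrano2025_thm11_monatomic → CompressibleEulerLocalWellPosedness →
  CaolaboraEtAl2025_thm12_rates`.
-/

noncomputable section

namespace Summit.AtomisticToContinuum.HydrodynamicLimit.Theorems

open Set Filter Topology Metric Function
open scoped ContDiff
open Literature.MathematicalPhysics.KineticTheory
open Literature.Analysis.FunctionSpaces Literature.Analysis.FunctionSpaces.Torus
open Literature.Analysis.FluidPDE (IsIsentropicEulerSolution CompressibleEulerLocalWellPosedness
  CaolaboraEtAl2025_thm12_rates BuckmasterCaolaboraGomezserrano2025_thm11_monatomic)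
open Literature.Analysis.FluidPDE.CaolaboraEtAl2025

/-! ## Elementary preliminaries -/

/-- **Positivity of the far-field sound-speed coefficient on `[0, ∞)`**: if
`S(ζ) = ζ^{1−r}B(ζ^{−r})` for `ζ > 0` with `S > 0` on `[0, ∞)`, `r > 0` and `B(0) > 0`, then
`B > 0` on `[0, ∞)`. [folklore] -/
theorem farField_B_pos {r : ℝ} {S B : ℝ → ℝ} (hr : 0 < r)
    (hSrep : ∀ ζ : ℝ, 0 < ζ → S ζ = ζ ^ (1 - r) * B (ζ ^ (-r)))
    (hSpos : ∀ ζ : ℝ, 0 ≤ ζ → 0 < S ζ) (hB00 : 0 < B 0) :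
    ∀ τ : ℝ, 0 ≤ τ → 0 < B τ := by
  intro τ hτ
  rcases hτ.eq_or_lt with h | hτpos
  · rw [← h]; exact hB00
  · set ζ : ℝ := τ ^ (-1 / r) with hζ
    have hζpos : 0 < ζ := Real.rpow_pos_of_pos hτpos _
    have hζr : ζ ^ (-r) = τ := by
      rw [hζ, ← Real.rpow_mul hτpos.le, show (-1 / r) * (-r) = 1 by field_simp, Real.rpow_one]
    have h1 := hSrep ζ hζpos
    rw [hζr] at h1
    have h2 : 0 < ζ ^ (1 - r) * B τ := by rw [← h1]; exact hSpos ζ hζpos.le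
    exact (mul_pos_iff_of_pos_left (Real.rpow_pos_of_pos hζpos _)).1 h2

/-- **A positive continuous function on `[0, 1]` is bounded below by a positive constant there.**
[folklore] -/
theorem exists_pos_lower_Icc {f : ℝ → ℝ} (hf : ContinuousOn f (Icc 0 1))
    (hpos : ∀ τ ∈ Icc (0 : ℝ) 1, 0 < f τ) : ∃ m : ℝ, 0 < m ∧ ∀ τ ∈ Icc (0 : ℝ) 1, m ≤ f τ := by
  obtain ⟨τ₀, hτ₀, hmin⟩ := isCompact_Icc.exists_isMinOn (nonempty_Icc.2 zero_le_one) hf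
  exact ⟨f τ₀, hpos τ₀ hτ₀, fun τ hτ => hmin hτ⟩

/-- **The choice of the blow-up time.** Given `T_b > 0`, `r` and `c ≥ 0` there are `0 < T < T'`
with `T ≤ 1`, `T' < T_b`, `T'·64^r ≤ 1` and `c T' < 1/32`. [folklore] -/
theorem exists_small_times {Tb r c : ℝ} (hTb : 0 < Tb) (hc : 0 ≤ c) :
    ∃ T T' : ℝ, 0 < T ∧ T < T' ∧ T ≤ 1 ∧ T' < Tb ∧ T' * 64 ^ r ≤ 1 ∧ c * T' < 1 / 32 := by
  set T' : ℝ := min (Tb / 2) (min ((64 : ℝ) ^ (-r)) (1 / (64 * (c + 1)))) with hT'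
  have h64 : 0 < (64 : ℝ) ^ (-r) := Real.rpow_pos_of_pos (by norm_num) _
  have hT'pos : 0 < T' := lt_min (by linarith) (lt_min h64 (by positivity))
  refine ⟨min (T' / 2) 1, T', lt_min (by linarith) one_pos,
    lt_of_le_of_lt (min_le_left _ _) (by linarith), min_le_right _ _,
    lt_of_le_of_lt (min_le_left _ _) (by linarith), ?_, ?_⟩
  · have h1 : T' ≤ (64 : ℝ) ^ (-r) := (min_le_right _ _).trans (min_le_left _ _)
    have h2 : (64 : ℝ) ^ (-r) * 64 ^ r = 1 := by
      rw [← Real.rpow_add (by norm_num : (0 : ℝ) < 64), neg_add_cancel, Real.rpow_zero]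
    calc T' * 64 ^ r ≤ (64 : ℝ) ^ (-r) * 64 ^ r :=
          mul_le_mul_of_nonneg_right h1 (Real.rpow_pos_of_pos (by norm_num) _).le
      _ = 1 := h2
  · have h1 : T' ≤ 1 / (64 * (c + 1)) := (min_le_right _ _).trans (min_le_right _ _)
    have h2 : c * T' ≤ c * (1 / (64 * (c + 1))) := mul_le_mul_of_nonneg_left h1 hc
    have h3 : c * (1 / (64 * (c + 1))) < 1 / 32 := by
      rw [mul_one_div, div_lt_div_iff₀ (by positivity) (by norm_num)]
      nlinarith
    exact lt_of_le_of_lt h2 h3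

/-! ## The assembly -/

/-- **The CGSS implosion of the monatomic gas on `𝕋³` with its rates, from the BCG profile and
local well-posedness.** See the module docstring for the construction (exact self-similar core,
backward exterior solution, domain of dependence, glue) and the sources of the four rate
clauses. [cite: CaolaboraEtAl2025, Thm 1.2 + Rem 1.4 + Rem 1.5 p. 7]
[cite: BuckmasterCaolaboraGomezserrano2025, Thm 1.1] [cite: Majda1984, Ch. 2 Thm 2.1]
[cite: Dafermos2005, Thm 5.2.1] -/
theorem thm12_rates_of_thm11_of_lwp (hBCG : BuckmasterCaolaboraGomezserrano2025_thm11_monatomic)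
    (hLWP : CompressibleEulerLocalWellPosedness) : CaolaboraEtAl2025_thm12_rates := by
  classical
  -- (1) the profile and its far field
  obtain ⟨r, hr1', hr2', U, S, hU, hS, hode, hSpos, hlimU, hlimS⟩ := hBCG
  have hr1 : 1 < r := by linarith
  have hr2 : r < 2 := by linarith
  have hr0 : 0 < r := by linarith
  obtain ⟨A, B, hA, hB, hB00, hrep⟩ := farField_of_profile hr1 hr2 hU hS hode hSpos hlimU hlimS
  have hUrep : ∀ ζ : ℝ, 0 < ζ → U ζ = ζ ^ (1 - r) * A (ζ ^ (-r)) := fun ζ hζ => (hrep ζ hζ).1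
  have hSrep : ∀ ζ : ℝ, 0 < ζ → S ζ = ζ ^ (1 - r) * B (ζ ^ (-r)) := fun ζ hζ => (hrep ζ hζ).2
  have hB0 : ∀ τ : ℝ, 0 ≤ τ → 0 < B τ := farField_B_pos hr0 hSrep hSpos hB00
  -- bounds for `A`, `B` on `[0, 1]`
  obtain ⟨MA, hMA'⟩ := isCompact_Icc.exists_bound_of_continuousOn
    (hA.continuous.continuousOn (s := Icc (0 : ℝ) 1))
  obtain ⟨MB, hMB'⟩ := isCompact_Icc.exists_bound_of_continuousOn
    (hB.continuous.continuousOn (s := Icc (0 : ℝ) 1))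
  have hMA : ∀ τ ∈ Icc (0 : ℝ) 1, |A τ| ≤ MA := fun τ hτ => by
    simpa only [Real.norm_eq_abs] using hMA' τ hτ
  have hMB : ∀ τ ∈ Icc (0 : ℝ) 1, |B τ| ≤ MB := fun τ hτ => by
    simpa only [Real.norm_eq_abs] using hMB' τ hτ
  have hMA0 : 0 ≤ MA := (abs_nonneg _).trans (hMA 0 ⟨le_rfl, zero_le_one⟩)
  have hMB0 : 0 ≤ MB := (abs_nonneg _).trans (hMB 0 ⟨le_rfl, zero_le_one⟩)
  -- minima of `S` and `B` on `[0, 1]`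
  obtain ⟨mB, hmB0, hmB⟩ := exists_pos_lower_Icc hB.continuous.continuousOn fun τ hτ => hB0 τ hτ.1
  obtain ⟨mS, hmS0, hmS⟩ : ∃ mS : ℝ, 0 < mS ∧ ∀ ζ ∈ Icc (0 : ℝ) 1, mS ≤ S ζ := by
    set e₀ : V3 := EuclideanSpace.single (0 : Fin 3) (1 : ℝ) with he₀
    have hne : ∀ ζ : ℝ, ‖ζ • e₀‖ = |ζ| := fun ζ => by
      rw [norm_smul, he₀, PiLp.norm_single, norm_one, mul_one, Real.norm_eq_abs]
    have hcont : Continuous fun ζ : ℝ => S ‖ζ • e₀‖ :=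
      hS.continuous.comp (continuous_id.smul continuous_const)
    obtain ⟨m, hm0, hm⟩ := exists_pos_lower_Icc hcont.continuousOn
      fun ζ _ => hSpos _ (norm_nonneg _)
    refine ⟨m, hm0, fun ζ hζ => ?_⟩
    have h := hm ζ hζ
    rwa [hne, abs_of_nonneg hζ.1] at h
  -- (3a) the terminal far-field state as smooth torus data on an annulus
  set Pρ : V3 → ℝ := fun y => (r⁻¹ * ‖y‖ ^ (1 - r) * B 0 / 3) ^ 3 with hPρ
  set Pu : V3 → V3 := fun y => -((r⁻¹ * ‖y‖ ^ (-r) * A 0) • y) with hPu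
  have hPρs : ∀ y : V3, y ≠ 0 → ContDiffAt ℝ ∞ Pρ y := fun y hy =>
    (((contDiffAt_const.mul ((contDiffAt_norm ℝ hy).rpow_const_of_ne (norm_ne_zero_iff.2 hy))).mul
      contDiffAt_const).div_const _).pow _
  have hPus : ∀ y : V3, y ≠ 0 → ContDiffAt ℝ ∞ Pu y := fun y hy =>
    (((contDiffAt_const.mul ((contDiffAt_norm ℝ hy).rpow_const_of_ne (norm_ne_zero_iff.2 hy))).mul
      contDiffAt_const).smul contDiffAt_id).neg
  have hPρpos : ∀ y : V3, y ≠ 0 → 0 < Pρ y := fun y hy => by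
    have : 0 < ‖y‖ := norm_pos_iff.2 hy
    simp only [hPρ]
    have h1 : 0 < ‖y‖ ^ (1 - r) := Real.rpow_pos_of_pos this _
    positivity
  obtain ⟨ρD, uD, hρD, huD, hρDpos, hDagree⟩ := exists_torus_datum hPρs hPus hPρpos
  -- (3b) the backward exterior solution
  obtain ⟨Tb, hTb, ρb, ub, hsolb, hρb0, hub0⟩ := exists_isentropic_solution_of_lwp hLWP hρD huD hρDpos
  -- (3c) the blow-up time
  set c : ℝ := r⁻¹ * 64 ^ (r - 1) * (MA + MB) with hc
  have hc0 : 0 ≤ c := by positivity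
  obtain ⟨T, T', hT, hTT', hT1, hT'Tb, hT64, hcT⟩ := exists_small_times (r := r) hTb hc0
  have hTTb : T < Tb := hTT'.trans hT'Tb
  have hT'0 : 0 < T' := hT.trans hTT'
  -- (3d) domain of dependence: the exterior solution is the reversed far field on the annulus
  have hdata : ∀ y : V3, 1 / 40 ≤ ‖y‖ → ‖y‖ ≤ 1 / 5 →
      ub 0 (proj y) = -((r⁻¹ * ‖y‖ ^ (-r) * A 0) • y) ∧
        ρb 0 (proj y) = (r⁻¹ * ‖y‖ ^ (1 - r) * B 0 / 3) ^ 3 := by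
    intro y hy1 hy2
    obtain ⟨h1, h2⟩ := hDagree y hy1 hy2
    rw [hub0, hρb0, h2, h1]
    exact ⟨rfl, rfl⟩
  have hback : ∀ s ∈ Ico 0 T', ∀ y : V3, 1 / 16 ≤ ‖y‖ → ‖y‖ ≤ 1 / 8 →
      ub s (proj y) = -((r⁻¹ * ‖y‖ ^ (-r) * A (s * ‖y‖ ^ (-r))) • y) ∧
        ρb s (proj y) = (r⁻¹ * ‖y‖ ^ (1 - r) * B (s * ‖y‖ ^ (-r)) / 3) ^ 3 :=
    fun s hs y hy1 hy2 => backward_agreement hr1 hr2 hU hS hode hA hB hB0 hUrep hSrep hMA hMB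
      hT'0 hT'Tb hT64 hcT hsolb hdata hs hy1 hy2
  -- (3e) the exterior solution in forward time
  set ρτ : ℝ → T3 → ℝ := fun t x => ρb (T - t) x with hρτ
  set uτ : ℝ → T3 → V3 := fun t x => -ub (T - t) x with huτ
  have hτ : IsIsentropicEulerSolution (5 / 3) T ρτ uτ := isIsentropicEulerSolution_reverse hsolb hTTb
  have hsT : ∀ {t : ℝ}, t ∈ Ico 0 T → T - t ∈ Ioc 0 T := fun ht =>
    ⟨sub_pos.2 ht.2, by linarith [ht.1]⟩
  -- (2) the exact solution with blow-up time `T`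
  set Ub : V3 → V3 := fun y => (U ‖y‖ / ‖y‖) • y with hUb
  set Sb : V3 → ℝ := fun y => S ‖y‖ with hSb
  set uE : ℝ → V3 → V3 := fun t x => (r⁻¹ * (T - t) ^ (1 / r - 1)) • Ub ((T - t) ^ (-1 / r) • x)
    with huE
  set σE : ℝ → V3 → ℝ := fun t x => (r⁻¹ * (T - t) ^ (1 / r - 1)) * Sb ((T - t) ^ (-1 / r) • x)
    with hσE
  set ρE : ℝ → V3 → ℝ := fun t x => (σE t x / 3) ^ 3 with hρE
  obtain ⟨hEρs, hEus, hEpos, hEmass, hEmom, -, -⟩ := exactSolution_of_profile (T := T)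
    (u := uE) (σ := σE) (ρ := ρE) hr0 hU hS hode hSpos hUb hSb (fun _ _ => rfl) (fun _ _ => rfl)
    (fun _ _ => rfl)
  -- agreement of the exterior solution with the exact one on the annulus, all forward times
  have hagree : ∀ t ∈ Ico 0 T, ∀ w : V3, 1 / 16 ≤ ‖w‖ → ‖w‖ ≤ 1 / 8 →
      ρτ t (proj w) = ρE t w ∧ uτ t (proj w) = uE t w := by
    intro t ht w hw1 hw2
    have hw0 : w ≠ 0 := by
      intro h; rw [h, norm_zero] at hw1; norm_num at hw1
    have hs : T - t ∈ Ico 0 T' := ⟨(hsT ht).1.le, (hsT ht).2.trans_lt hTT'⟩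
    obtain ⟨hu, hρ⟩ := hback (T - t) hs w hw1 hw2
    obtain ⟨hfu, hfσ⟩ := farField_form (T := T) hr0 hUrep hSrep ht.2 hw0
    refine ⟨?_, ?_⟩
    · simp only [hρτ, hρE, hσE, hSb, hρ, hfσ]
    · simp only [huτ, huE, hUb, hu, hfu, neg_neg]
  have hagρ : ∀ t ∈ Ico 0 T, ∀ w : V3, 1 / 16 ≤ ‖w‖ → ‖w‖ ≤ 1 / 8 → ρτ t (proj w) = ρE t w :=
    fun t ht w hw1 hw2 => (hagree t ht w hw1 hw2).1
  have hagu : ∀ t ∈ Ico 0 T, ∀ w : V3, 1 / 16 ≤ ‖w‖ → ‖w‖ ≤ 1 / 8 → uτ t (proj w) = uE t w :=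
    fun t ht w hw1 hw2 => (hagree t ht w hw1 hw2).2
  -- (4) the glue
  obtain ⟨ψ, hψ, hψ1, hψ0⟩ := exists_glue_plateau
  set ρ₁ : ℝ → T3 → ℝ := fun t x => ρτ t x + transplant (fun w => ψ w • (ρE t w - ρτ t (proj w))) x
    with hρ₁
  set u₁ : ℝ → T3 → V3 := fun t x => uτ t x + transplant (fun w => ψ w • (uE t w - uτ t (proj w))) x
    with hu₁
  have hsol : IsIsentropicEulerSolution (5 / 3) T ρ₁ u₁ :=
    isIsentropicEulerSolution_glue hψ hψ1 hψ0 hEρs hEus hEpos hEmass hEmom hτ hagρ hagu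
  -- local structure of the glued fields
  have hcoreρ : ∀ x : T3, ‖reprc x‖ < 1 / 8 → ∀ t ∈ Ico 0 T,
      lift (ρ₁ t) =ᶠ[𝓝 (reprc x)] fun z =>
        (r⁻¹ * (T - t) ^ (1 / r - 1) * S ‖(T - t) ^ (-1 / r) • z‖ / 3) ^ 3 :=
    fun x hx t ht => (glue_core_nhds hψ1 hψ0 hagρ x hx ht).1
  have hcoreu : ∀ x : T3, ‖reprc x‖ < 1 / 8 → ∀ t ∈ Ico 0 T,
      lift (u₁ t) =ᶠ[𝓝 (reprc x)] fun z => (r⁻¹ * (T - t) ^ (1 / r - 1)) •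
        ((U ‖(T - t) ^ (-1 / r) • z‖ / ‖(T - t) ^ (-1 / r) • z‖) • ((T - t) ^ (-1 / r) • z)) :=
    fun x hx t ht => (glue_core_nhds hψ1 hψ0 hagu x hx ht).1
  have hextρ : ∀ x : T3, 1 / 8 ≤ ‖reprc x‖ → ∀ t ∈ Ico 0 T,
      lift (ρ₁ t) =ᶠ[𝓝 (reprc x)] lift (ρτ t) :=
    fun x hx t ht => (glue_exterior_nhds hψ0 hagρ x hx ht).1
  have hextu : ∀ x : T3, 1 / 8 ≤ ‖reprc x‖ → ∀ t ∈ Ico 0 T,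
      lift (u₁ t) =ᶠ[𝓝 (reprc x)] lift (uτ t) :=
    fun x hx t ht => (glue_exterior_nhds hψ0 hagu x hx ht).1
  -- smoothness and positivity of slices
  have hρ₁s : ∀ t ∈ Ico 0 T, IsSmooth (ρ₁ t) := fun t ht => hsol.smooth_density.isSmooth_slice ht
  have hu₁s : ∀ t ∈ Ico 0 T, IsSmooth (u₁ t) := fun t ht => hsol.smooth_velocity.isSmooth_slice ht
  have hρ₁pos : ∀ t ∈ Ico 0 T, ∀ x, 0 < ρ₁ t x := hsol.density_pos
  have hτρs : ∀ t ∈ Ico 0 T, IsSmooth (ρτ t) := fun t ht => hτ.smooth_density.isSmooth_slice ht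
  have hτus : ∀ t ∈ Ico 0 T, IsSmooth (uτ t) := fun t ht => hτ.smooth_velocity.isSmooth_slice ht
  have hτpos : ∀ t ∈ Ico 0 T, ∀ x, 0 < ρτ t x := hτ.density_pos
  -- compactness bounds for the exterior solution on `[0, T] × 𝕋³`
  obtain ⟨M₁, hM₁⟩ := exists_bound_partialDeriv_slice hsolb.smooth_velocity hTTb
  have hcb : IsSmoothSpaceTimeOn (Ico 0 Tb) (fun s x => ρb s x ^ (1 / 3 : ℝ)) :=
    hsolb.smooth_density.rpow_const_of_ne fun p hp =>
      (hsolb.density_pos p.1 (mem_prod.1 hp).1 _).ne'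
  obtain ⟨M₂, hM₂⟩ := exists_bound_partialDeriv_slice hcb hTTb
  have hM : ∀ t ∈ Ico 0 T, ∀ x (i : Fin 3), ‖partialDeriv i (uτ t) x‖ ≤ max M₁ M₂ ∧
      |partialDeriv i (fun y => ρτ t y ^ (1 / 3 : ℝ)) x| ≤ max M₁ M₂ := by
    intro t ht x i
    refine ⟨?_, ?_⟩
    · have h : partialDeriv i (uτ t) x = -partialDeriv i (ub (T - t)) x :=
        partialDeriv_neg_pt (ub (T - t)) i x
      rw [h, norm_neg]
      exact (hM₁ _ (hsT ht) x i).trans (le_max_left _ _)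
    · have h := hM₂ _ (hsT ht) x i
      rw [Real.norm_eq_abs] at h
      exact h.trans (le_max_right _ _)
  obtain ⟨cτ, hcτ0, hcτ⟩ := exists_pos_le_slice hsolb.smooth_density hsolb.density_pos hT.le hTTb
  have hcτ' : ∀ t ∈ Ico 0 T, ∀ x, cτ ≤ ρτ t x := fun t ht x =>
    hcτ _ ⟨(hsT ht).1.le, (hsT ht).2⟩ x
  have hMn : ∀ n : ℕ, ∃ Mn : ℝ, ∀ t ∈ Ico 0 T, ∀ y : V3,
      ‖iteratedFDeriv ℝ n (lift (ρτ t)) y‖ ≤ Mn ∧ ‖iteratedFDeriv ℝ n (lift (uτ t)) y‖ ≤ Mn := by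
    intro n
    obtain ⟨Mρ, hMρ⟩ := exists_bound_iteratedFDeriv_lift_slice hsolb.smooth_density hTTb n
    obtain ⟨Mu, hMu⟩ := exists_bound_iteratedFDeriv_lift_slice hsolb.smooth_velocity hTTb n
    refine ⟨max Mρ Mu, fun t ht y => ⟨(hMρ _ (hsT ht) y).trans (le_max_left _ _), ?_⟩⟩
    have h : lift (uτ t) = -lift (ub (T - t)) := rfl
    rw [h, iteratedFDeriv_neg_apply, norm_neg]
    exact (hMu _ (hsT ht) y).trans (le_max_right _ _)
  -- (5) the four rate clauses
  obtain ⟨C, hC⟩ := glue_typeI hr0 hU hS hode hSpos hlimU hlimS hρ₁s hu₁s hρ₁pos hτρs hτus hτpos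
    hcoreρ hcoreu hextρ hextu hM
  obtain ⟨cl, pl, hcl, hfloor⟩ := glue_floor hr1 hSrep hmS0 hmS hmB0 hmB hT hcoreρ hextρ hcτ0 hcτ'
  refine ⟨T, r, hT, hr1, ρ₁, u₁, hsol, ⟨C, hC⟩, fun n _ => ?_, ⟨cl, pl, hcl, hfloor⟩,
    ⟨(S 0 / (3 * r)) ^ 3, by have := hSpos 0 le_rfl; positivity, fun t ht => ⟨proj 0, ?_⟩⟩⟩
  · obtain ⟨Mn, hMn'⟩ := hMn n
    exact glue_iteratedFDeriv_le hr1 hr2 hU hS hode hSpos hlimU hlimS hT1 hcoreρ hcoreu hextρ hextu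
      n hMn'
  · exact (glue_core_law hr0 hcoreρ ht).symm.le

end Summit.AtomisticToContinuum.HydrodynamicLimit.Theorems

end
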